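import Summits.CriticalPhenomena.PercolationContinuityZ3.Theorems.Transplant.FKConnectivityAllQPat3TwoLevelDefs
import Summits.CriticalPhenomena.PercolationContinuityZ3.Theorems.Transplant.FKConnectivityAllQAntipodalUpc
import HarnessLib

/-!
# Connectivity correlation inequalities for `φ_{w,q}`, every `q > 0` — TWO-LEVEL THREE-MARK MEMBERS: symmetrisation,
# domination (halves allowed), fibre decomposition and the gluing steps

Theorems file (`--supports stmt-CriticalPhenomena-4575`), census lane `prim-bschramm-census` (gen 36) of the post-continuity programme (LANE 2 bschramm, FK sub-lane);
builds on p205010 (kernel theorem, internal audit signed; external expert review pending).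
No definitions, no named facts, no sorries; standard axioms.  The two-level analogue of `…Pat3Functionals.lean`:
`FK.lval4_flip` / `FK.mval2_flip` (involution `γ ↦ E ∖ γ`), linearity, `FK.mval2_zero`, `FK.mval2_mono`, `FK.lval4_shift2`,
`FK.lval4_dom` (domination after symmetrisation: `2(F+Fᵀ) ≥ m·(shift2 G k + ᵀ)` coefficientwise ⇒ `m·mval2 (w+k) G ≤ 2·lval4 w F`),
`FK.fib2_sum` / `FK.mval2_union_eq` (fibre decomposition of `mval2` over a two-mark side), and the gluing steps
`FK.mval2_union_nonneg` (class-dependent dominating members `G a a'`, valid on the three-mark side) / `FK.mval2_union_nonneg₂`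
(both sides two-mark).
[cite: Grimmett2006, §3.8 (pp. 61–62)] [cite: AyyerLinussonRavichandran2025, §7 (p. 22)]
-/

noncomputable section

namespace Summit.CriticalPhenomena.PercolationContinuityZ3.Theorems

namespace FK

open SimpleGraph Literature.Probability.LatticeModels Literature.Probability.Percolation

open scoped Classical

variable {V : Type*}

section Functionals

variable {w : ℕ → ℝ} {E : Finset (Sym2 V)} {x y s : V}

/-- `lval4` is invariant under transposing the table (the involution `γ ↦ E ∖ γ`). [folklore] -/
theorem lval4_flip (G : ℕ → Pat3 → Pat3 → ℤ) : lval4 w E x y s G = lval4 w E x y s (fun c P Q => G c Q P) := by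
  unfold lval4
  rw [sum_powerset_flip E (fun γ => ∑ c ∈ Finset.range 4,
    w (apExp E γ + c) * ((fun c P Q => G c Q P) c (pat3 γ x y s) (pat3 (E \ γ) x y s) : ℝ))]
  refine Finset.sum_congr rfl fun γ hγ => ?_
  have hγE := Finset.mem_powerset.1 hγ
  simp only [Finset.sdiff_sdiff_eq_self hγE, apExp_compl hγE]

/-- `mval2` is invariant under transposing both levels of the member. [folklore] -/
theorem mval2_flip (F : ℕ → Pat3 → Pat3 → ℤ) : mval2 w E x y s F = mval2 w E x y s (fun c P Q => F c Q P) := by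
  unfold mval2
  rw [sum_powerset_flip E (fun γ => w (apExp E γ) * ((fun c P Q => F c Q P) 0 (pat3 γ x y s) (pat3 (E \ γ) x y s) : ℝ) +
    w (apExp E γ + 1) * ((fun c P Q => F c Q P) 1 (pat3 γ x y s) (pat3 (E \ γ) x y s) : ℝ))]
  refine Finset.sum_congr rfl fun γ hγ => ?_
  have hγE := Finset.mem_powerset.1 hγ
  simp only [Finset.sdiff_sdiff_eq_self hγE, apExp_compl hγE]

/-- A four-level table with nonnegative coefficients evaluates nonnegatively against nonnegative weights. [folklore] -/
theorem lval4_nonneg_of_coef {G : ℕ → Pat3 → Pat3 → ℤ} (hG : ∀ c < 4, ∀ P Q, 0 ≤ G c P Q) (hw : ∀ n, 0 ≤ w n) :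
    0 ≤ lval4 w E x y s G := by
  unfold lval4
  refine Finset.sum_nonneg fun γ _ => Finset.sum_nonneg fun c hc => mul_nonneg (hw _) ?_
  exact_mod_cast hG c (Finset.mem_range.1 hc) _ _

/-- A two-level member dominating another coefficientwise evaluates at least as large (nonnegative weights). [folklore] -/
theorem mval2_mono {F F' : ℕ → Pat3 → Pat3 → ℤ} (h : ∀ c < 2, ∀ P Q, F c P Q ≤ F' c P Q) (hw : ∀ n, 0 ≤ w n) :
    mval2 w E x y s F ≤ mval2 w E x y s F' := by
  unfold mval2
  refine Finset.sum_le_sum fun γ _ => add_le_add (mul_le_mul_of_nonneg_left ?_ (hw _)) (mul_le_mul_of_nonneg_left ?_ (hw _))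
  · exact_mod_cast h 0 (by norm_num) _ _
  · exact_mod_cast h 1 (by norm_num) _ _

/-- The zero member evaluates to zero. [folklore] -/
theorem mval2_zero : mval2 w E x y s (fun _ _ _ => 0) = 0 := by
  unfold mval2
  simp

/-- Linearity of `lval4`: sums. [folklore] -/
theorem lval4_add (G H : ℕ → Pat3 → Pat3 → ℤ) :
    lval4 w E x y s (fun c P Q => G c P Q + H c P Q) = lval4 w E x y s G + lval4 w E x y s H := by
  unfold lval4
  rw [← Finset.sum_add_distrib]
  refine Finset.sum_congr rfl fun γ _ => ?_
  rw [← Finset.sum_add_distrib]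
  refine Finset.sum_congr rfl fun c _ => ?_
  push_cast
  ring

/-- Linearity of `lval4`: differences. [folklore] -/
theorem lval4_sub (G H : ℕ → Pat3 → Pat3 → ℤ) :
    lval4 w E x y s (fun c P Q => G c P Q - H c P Q) = lval4 w E x y s G - lval4 w E x y s H := by
  unfold lval4
  rw [← Finset.sum_sub_distrib]
  refine Finset.sum_congr rfl fun γ _ => ?_
  rw [← Finset.sum_sub_distrib]
  refine Finset.sum_congr rfl fun c _ => ?_
  push_cast
  ring

/-- Linearity of `lval4`: integer multiples. [folklore] -/
theorem lval4_smul (m : ℤ) (G : ℕ → Pat3 → Pat3 → ℤ) :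
    lval4 w E x y s (fun c P Q => m * G c P Q) = m * lval4 w E x y s G := by
  unfold lval4
  rw [Finset.mul_sum]
  refine Finset.sum_congr rfl fun γ _ => ?_
  rw [Finset.mul_sum]
  refine Finset.sum_congr rfl fun c _ => ?_
  push_cast
  ring

/-- A two-level member placed `k ≤ 2` levels up evaluates as the member against the shifted weights. [folklore] -/
theorem lval4_shift2 {k : ℕ} (hk : k + 1 < 4) (F : ℕ → Pat3 → Pat3 → ℤ) :
    lval4 w E x y s (shift2 F k) = mval2 (fun n => w (n + k)) E x y s F := by
  unfold lval4 mval2 shift2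
  refine Finset.sum_congr rfl fun γ _ => ?_
  have hk0 : k ∈ Finset.range 4 := Finset.mem_range.2 (by omega)
  have hk1 : k + 1 ∈ Finset.range 4 := Finset.mem_range.2 hk
  simp only [Int.cast_add, mul_add, Finset.sum_add_distrib]
  congr 1
  · rw [Finset.sum_eq_single_of_mem k hk0]
    · simp
    · intro c _ hc
      simp [hc]
  · rw [Finset.sum_eq_single_of_mem (k + 1) hk1]
    · have e1 : apExp E γ + 1 + k = apExp E γ + (k + 1) := by omega
      simp [e1]
    · intro c _ hc
      simp [hc]

/-- **Domination after symmetrisation (two-level member, halves allowed)**: if `2·(F + Fᵀ) ≥ m · (shift2 G k + (shift2 G k)ᵀ)`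
coefficientwise, then `m · mval2 (w shifted by k) G ≤ 2 · lval4 w F` for nonnegative weights. [folklore] -/
theorem lval4_dom {F G : ℕ → Pat3 → Pat3 → ℤ} {m k : ℕ} (hk : k + 1 < 4)
    (hdom : ∀ c < 4, ∀ P Q, (m : ℤ) * (shift2 G k c P Q + shift2 G k c Q P) ≤ 2 * (F c P Q + F c Q P))
    (hw : ∀ n, 0 ≤ w n) : (m : ℝ) * mval2 (fun n => w (n + k)) E x y s G ≤ 2 * lval4 w E x y s F := by
  have h1 : mval2 (fun n => w (n + k)) E x y s G = lval4 w E x y s (shift2 G k) := (lval4_shift2 hk G).symm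
  have h2 : lval4 w E x y s (shift2 G k) = lval4 w E x y s (fun c P Q => shift2 G k c Q P) := lval4_flip _
  have h3 : lval4 w E x y s F = lval4 w E x y s (fun c P Q => F c Q P) := lval4_flip F
  have key : 0 ≤ lval4 w E x y s
      (fun c P Q => 2 * (F c P Q + F c Q P) - (m : ℤ) * (shift2 G k c P Q + shift2 G k c Q P)) := by
    refine lval4_nonneg_of_coef (fun c hc P Q => ?_) hw
    have := hdom c hc P Q
    linarith
  rw [lval4_sub, lval4_smul, lval4_add, lval4_smul, lval4_add, ← h2, ← h3] at key
  push_cast at key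
  rw [h1]
  nlinarith

/-! ### Fibres of a gluing (two-level member) -/

/-- The inner sum over the three-mark side is the evaluation of the fibre table of the two-level member. [folklore] -/
theorem fib2_sum {join : Bool → Pat3 → Pat3} {corr : Bool → Pat3 → ℕ} (hcorr : ∀ a P, corr a P ≤ 1)
    (w' : ℕ → ℝ) (EB : Finset (Sym2 V)) (xB yB sB : V) (F : ℕ → Pat3 → Pat3 → ℤ) (a a' : Bool) :
    ∑ γ ∈ EB.powerset,
      (w' (apExp EB γ + (corr a (pat3 γ xB yB sB) + corr a' (pat3 (EB \ γ) xB yB sB))) *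
          (F 0 (join a (pat3 γ xB yB sB)) (join a' (pat3 (EB \ γ) xB yB sB)) : ℝ) +
        w' (apExp EB γ + (corr a (pat3 γ xB yB sB) + corr a' (pat3 (EB \ γ) xB yB sB)) + 1) *
          (F 1 (join a (pat3 γ xB yB sB)) (join a' (pat3 (EB \ γ) xB yB sB)) : ℝ)) =
      lval4 w' EB xB yB sB (fib2 F join corr a a') := by
  unfold lval4 fib2
  refine Finset.sum_congr rfl fun γ _ => ?_
  set C := corr a (pat3 γ xB yB sB) + corr a' (pat3 (EB \ γ) xB yB sB) with hC
  have hC2 : C ≤ 2 := by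
    have := hcorr a (pat3 γ xB yB sB)
    have := hcorr a' (pat3 (EB \ γ) xB yB sB)
    omega
  have hC4 : C ∈ Finset.range 4 := Finset.mem_range.2 (by omega)
  have hC4' : C + 1 ∈ Finset.range 4 := Finset.mem_range.2 (by omega)
  simp only [Int.cast_add, Int.cast_ite, Int.cast_zero, mul_add, Finset.sum_add_distrib]
  congr 1
  · rw [Finset.sum_eq_single_of_mem C hC4]
    · simp
    · intro c _ hc
      simp [Ne.symm hc]
  · rw [Finset.sum_eq_single_of_mem (C + 1) hC4']
    · simp [add_assoc]
    · intro c _ hc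
      simp [Ne.symm hc]

variable [Fintype V]

/-- **Gluing decomposition of `mval2`** over a two-mark side (see `FK.tval_union_eq` for the one-level version). [folklore] -/
theorem mval2_union_eq {EA EB : Finset (Sym2 V)} (hd : Disjoint EA EB) {x y s xB yB sB : V}
    (cls : Finset (Sym2 V) → Bool) (join : Bool → Pat3 → Pat3) (corr : Bool → Pat3 → ℕ)
    (hpat : ∀ γA ⊆ EA, ∀ γB ⊆ EB, pat3 (γA ∪ γB) x y s = join (cls γA) (pat3 γB xB yB sB))
    (hexp : ∀ γA ⊆ EA, ∀ γB ⊆ EB, apExp (EA ∪ EB) (γA ∪ γB) + 2 * Fintype.card V =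
      apExp EA γA + apExp EB γB + (corr (cls γA) (pat3 γB xB yB sB) + corr (cls (EA \ γA)) (pat3 (EB \ γB) xB yB sB)))
    (hcorr : ∀ a P, corr a P ≤ 1) (w : ℕ → ℝ) (F : ℕ → Pat3 → Pat3 → ℤ) :
    mval2 (fun n => w (n + 2 * Fintype.card V)) (EA ∪ EB) x y s F =
      ∑ γA ∈ EA.powerset, lval4 (fun n => w (apExp EA γA + n)) EB xB yB sB (fib2 F join corr (cls γA) (cls (EA \ γA))) := by
  unfold mval2
  beta_reduce
  rw [sum_powerset_union_disj hd]
  refine Finset.sum_congr rfl fun γA hγA => ?_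
  have hγA' := Finset.mem_powerset.1 hγA
  rw [← fib2_sum hcorr]
  refine Finset.sum_congr rfl fun γB hγB => ?_
  have hγB' := Finset.mem_powerset.1 hγB
  have e1 : apExp (EA ∪ EB) (γA ∪ γB) + 2 * Fintype.card V =
      apExp EA γA + (apExp EB γB + (corr (cls γA) (pat3 γB xB yB sB) + corr (cls (EA \ γA)) (pat3 (EB \ γB) xB yB sB))) := by
    rw [hexp γA hγA' γB hγB', add_assoc]
  have e2 : apExp (EA ∪ EB) (γA ∪ γB) + 1 + 2 * Fintype.card V =
      apExp EA γA + (apExp EB γB + (corr (cls γA) (pat3 γB xB yB sB) + corr (cls (EA \ γA)) (pat3 (EB \ γB) xB yB sB)) + 1) := by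
    have := hexp γA hγA' γB hγB'
    omega
  rw [union_sdiff_union hd hγA' hγB', hpat γA hγA' γB hγB', hpat (EA \ γA) Finset.sdiff_subset (EB \ γB) Finset.sdiff_subset,
    e1, e2]

/-- **Gluing step for a two-level member** (two-mark side `A`, three-mark side `B`): if, for every class `(a, a')` of the
two-mark side, the fibre of `F` in the class plus its fibre in the swapped class dominates (doubled, after symmetrisation)
`m a a'` times a member `G a a'` placed `k a a'` levels up, and every `G a a'` evaluates nonnegatively on `B` for all nonnegative
weights, then `F` evaluates nonnegatively on the union.  (Classes are paired through `γ_A ↦ E_A ∖ γ_A`.) [folklore] -/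
theorem mval2_union_nonneg {EA EB : Finset (Sym2 V)} (hd : Disjoint EA EB) {x y s xB yB sB : V}
    (cls : Finset (Sym2 V) → Bool) (join : Bool → Pat3 → Pat3) (corr : Bool → Pat3 → ℕ)
    (hpat : ∀ γA ⊆ EA, ∀ γB ⊆ EB, pat3 (γA ∪ γB) x y s = join (cls γA) (pat3 γB xB yB sB))
    (hexp : ∀ γA ⊆ EA, ∀ γB ⊆ EB, apExp (EA ∪ EB) (γA ∪ γB) + 2 * Fintype.card V =
      apExp EA γA + apExp EB γB + (corr (cls γA) (pat3 γB xB yB sB) + corr (cls (EA \ γA)) (pat3 (EB \ γB) xB yB sB)))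
    (hcorr : ∀ a P, corr a P ≤ 1) (F : ℕ → Pat3 → Pat3 → ℤ) (G : Bool → Bool → ℕ → Pat3 → Pat3 → ℤ) (m k : Bool → Bool → ℕ)
    (hk : ∀ a a', k a a' + 1 < 4)
    (hdom : ∀ a a', ∀ c < 4, ∀ P Q,
      (m a a' : ℤ) * (shift2 (G a a') (k a a') c P Q + shift2 (G a a') (k a a') c Q P) ≤
        2 * ((fib2 F join corr a a' c P Q + fib2 F join corr a' a c P Q) + (fib2 F join corr a a' c Q P + fib2 F join corr a' a c Q P)))
    (ihG : ∀ a a', ∀ w' : ℕ → ℝ, (∀ n, 0 ≤ w' n) → 0 ≤ mval2 w' EB xB yB sB (G a a'))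
    (w : ℕ → ℝ) (hw : ∀ n, 0 ≤ w n) : 0 ≤ mval2 w (EA ∪ EB) x y s F := by
  set w₂ : ℕ → ℝ := fun n => w (n - 2 * Fintype.card V) with hw₂
  have hw₂' : ∀ n, 0 ≤ w₂ n := fun n => hw _
  have hrew : mval2 w (EA ∪ EB) x y s F = mval2 (fun n => w₂ (n + 2 * Fintype.card V)) (EA ∪ EB) x y s F := by
    simp only [hw₂, Nat.add_sub_cancel]
  rw [hrew, mval2_union_eq hd cls join corr hpat hexp hcorr w₂ F]
  set Φ : Finset (Sym2 V) → ℝ := fun γA =>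
    lval4 (fun n => w₂ (apExp EA γA + n)) EB xB yB sB (fib2 F join corr (cls γA) (cls (EA \ γA))) with hΦ
  have hpair : ∀ γA ∈ EA.powerset, 0 ≤ Φ γA + Φ (EA \ γA) := by
    intro γA hγA
    have hγA' := Finset.mem_powerset.1 hγA
    simp only [hΦ]
    rw [Finset.sdiff_sdiff_eq_self hγA', apExp_compl hγA', ← lval4_add]
    have hwA : ∀ n, 0 ≤ w₂ (apExp EA γA + n) := fun n => hw₂' _
    have h1 := lval4_dom (E := EB) (x := xB) (y := yB) (s := sB) (w := fun n => w₂ (apExp EA γA + n))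
      (F := fun c P Q => fib2 F join corr (cls γA) (cls (EA \ γA)) c P Q + fib2 F join corr (cls (EA \ γA)) (cls γA) c P Q)
      (hk (cls γA) (cls (EA \ γA))) (hdom (cls γA) (cls (EA \ γA))) hwA
    have h2 : 0 ≤ mval2 (fun n => w₂ (apExp EA γA + (n + k (cls γA) (cls (EA \ γA))))) EB xB yB sB
        (G (cls γA) (cls (EA \ γA))) :=
      ihG _ _ _ fun n => hw₂' _
    have h3 : (0 : ℝ) ≤ (m (cls γA) (cls (EA \ γA)) : ℝ) := Nat.cast_nonneg _
    nlinarith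
  have hsum : ∑ γA ∈ EA.powerset, Φ γA + ∑ γA ∈ EA.powerset, Φ (EA \ γA) =
      2 * ∑ γA ∈ EA.powerset, Φ γA := by
    rw [← sum_powerset_flip EA Φ]; ring
  have h2 : 0 ≤ ∑ γA ∈ EA.powerset, (Φ γA + Φ (EA \ γA)) := Finset.sum_nonneg hpair
  rw [Finset.sum_add_distrib, hsum] at h2
  have : ∑ γA ∈ EA.powerset, Φ γA = ∑ γA ∈ EA.powerset,
      lval4 (fun n => w₂ (apExp EA γA + n)) EB xB yB sB (fib2 F join corr (cls γA) (cls (EA \ γA))) := rfl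
  rw [← this]
  linarith

/-- **Gluing step at the mark for a two-level member** (both sides two-mark): a termwise certificate after symmetrising one
side's bit pair gives nonnegativity on the union. [folklore] -/
theorem mval2_union_nonneg₂ {E₁ E₂ : Finset (Sym2 V)} (hd : Disjoint E₁ E₂) {x y s : V}
    (c₁ c₂ : Finset (Sym2 V) → Bool)
    (hpat : ∀ γ₁ ⊆ E₁, ∀ γ₂ ⊆ E₂, pat3 (γ₁ ∪ γ₂) x y s = joinSerS (c₁ γ₁) (c₂ γ₂))
    (hexp : ∀ γ₁ ⊆ E₁, ∀ γ₂ ⊆ E₂, apExp (E₁ ∪ E₂) (γ₁ ∪ γ₂) + 2 * Fintype.card V = apExp E₁ γ₁ + apExp E₂ γ₂)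
    (F : ℕ → Pat3 → Pat3 → ℤ)
    (hcert : ∀ a a' b b' : Bool, ∀ c < 2, 0 ≤ F c (joinSerS a b) (joinSerS a' b') + F c (joinSerS a b') (joinSerS a' b))
    (w : ℕ → ℝ) (hw : ∀ n, 0 ≤ w n) : 0 ≤ mval2 w (E₁ ∪ E₂) x y s F := by
  set w₂ : ℕ → ℝ := fun n => w (n - 2 * Fintype.card V) with hw₂
  have hw₂' : ∀ n, 0 ≤ w₂ n := fun n => hw _
  have hrew : mval2 w (E₁ ∪ E₂) x y s F = mval2 (fun n => w₂ (n + 2 * Fintype.card V)) (E₁ ∪ E₂) x y s F := by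
    simp only [hw₂, Nat.add_sub_cancel]
  rw [hrew]
  unfold mval2
  beta_reduce
  rw [sum_powerset_union_disj hd]
  refine Finset.sum_nonneg fun γ₁ hγ₁ => ?_
  have hγ₁' := Finset.mem_powerset.1 hγ₁
  set Ψ : Finset (Sym2 V) → ℝ := fun γ₂ =>
    w₂ (apExp (E₁ ∪ E₂) (γ₁ ∪ γ₂) + 2 * Fintype.card V) *
        (F 0 (pat3 (γ₁ ∪ γ₂) x y s) (pat3 ((E₁ ∪ E₂) \ (γ₁ ∪ γ₂)) x y s) : ℝ) +
      w₂ (apExp (E₁ ∪ E₂) (γ₁ ∪ γ₂) + 1 + 2 * Fintype.card V) *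
        (F 1 (pat3 (γ₁ ∪ γ₂) x y s) (pat3 ((E₁ ∪ E₂) \ (γ₁ ∪ γ₂)) x y s) : ℝ) with hΨ
  have hpair : ∀ γ₂ ∈ E₂.powerset, 0 ≤ Ψ γ₂ + Ψ (E₂ \ γ₂) := by
    intro γ₂ hγ₂
    have hγ₂' := Finset.mem_powerset.1 hγ₂
    have e0 : apExp (E₁ ∪ E₂) (γ₁ ∪ γ₂) + 2 * Fintype.card V = apExp E₁ γ₁ + apExp E₂ γ₂ := hexp γ₁ hγ₁' γ₂ hγ₂'
    have e0' : apExp (E₁ ∪ E₂) (γ₁ ∪ (E₂ \ γ₂)) + 2 * Fintype.card V = apExp E₁ γ₁ + apExp E₂ γ₂ := by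
      rw [hexp γ₁ hγ₁' (E₂ \ γ₂) Finset.sdiff_subset, apExp_compl hγ₂']
    have e1 : apExp (E₁ ∪ E₂) (γ₁ ∪ γ₂) + 1 + 2 * Fintype.card V = apExp E₁ γ₁ + apExp E₂ γ₂ + 1 := by omega
    have e1' : apExp (E₁ ∪ E₂) (γ₁ ∪ (E₂ \ γ₂)) + 1 + 2 * Fintype.card V = apExp E₁ γ₁ + apExp E₂ γ₂ + 1 := by omega
    simp only [hΨ]
    rw [union_sdiff_union hd hγ₁' hγ₂', union_sdiff_union hd hγ₁' Finset.sdiff_subset, Finset.sdiff_sdiff_eq_self hγ₂',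
      e0, e0', e1, e1',
      hpat γ₁ hγ₁' γ₂ hγ₂', hpat (E₁ \ γ₁) Finset.sdiff_subset (E₂ \ γ₂) Finset.sdiff_subset,
      hpat γ₁ hγ₁' (E₂ \ γ₂) Finset.sdiff_subset, hpat (E₁ \ γ₁) Finset.sdiff_subset γ₂ hγ₂']
    have c0 := hcert (c₁ γ₁) (c₁ (E₁ \ γ₁)) (c₂ γ₂) (c₂ (E₂ \ γ₂)) 0 (by norm_num)
    have c1 := hcert (c₁ γ₁) (c₁ (E₁ \ γ₁)) (c₂ γ₂) (c₂ (E₂ \ γ₂)) 1 (by norm_num)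
    have hw0 := hw₂' (apExp E₁ γ₁ + apExp E₂ γ₂)
    have hw1 := hw₂' (apExp E₁ γ₁ + apExp E₂ γ₂ + 1)
    have c0' : (0 : ℝ) ≤ (F 0 (joinSerS (c₁ γ₁) (c₂ γ₂)) (joinSerS (c₁ (E₁ \ γ₁)) (c₂ (E₂ \ γ₂))) : ℝ) +
        (F 0 (joinSerS (c₁ γ₁) (c₂ (E₂ \ γ₂))) (joinSerS (c₁ (E₁ \ γ₁)) (c₂ γ₂)) : ℝ) := by exact_mod_cast c0
    have c1' : (0 : ℝ) ≤ (F 1 (joinSerS (c₁ γ₁) (c₂ γ₂)) (joinSerS (c₁ (E₁ \ γ₁)) (c₂ (E₂ \ γ₂))) : ℝ) +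
        (F 1 (joinSerS (c₁ γ₁) (c₂ (E₂ \ γ₂))) (joinSerS (c₁ (E₁ \ γ₁)) (c₂ γ₂)) : ℝ) := by exact_mod_cast c1
    nlinarith
  have hsum : ∑ γ₂ ∈ E₂.powerset, Ψ γ₂ + ∑ γ₂ ∈ E₂.powerset, Ψ (E₂ \ γ₂) = 2 * ∑ γ₂ ∈ E₂.powerset, Ψ γ₂ := by
    rw [← sum_powerset_flip E₂ Ψ]; ring
  have h2 : 0 ≤ ∑ γ₂ ∈ E₂.powerset, (Ψ γ₂ + Ψ (E₂ \ γ₂)) := Finset.sum_nonneg hpair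
  rw [Finset.sum_add_distrib, hsum] at h2
  have : ∑ γ₂ ∈ E₂.powerset, Ψ γ₂ = ∑ γ₂ ∈ E₂.powerset,
      (w₂ (apExp (E₁ ∪ E₂) (γ₁ ∪ γ₂) + 2 * Fintype.card V) *
          (F 0 (pat3 (γ₁ ∪ γ₂) x y s) (pat3 ((E₁ ∪ E₂) \ (γ₁ ∪ γ₂)) x y s) : ℝ) +
        w₂ (apExp (E₁ ∪ E₂) (γ₁ ∪ γ₂) + 1 + 2 * Fintype.card V) *
          (F 1 (pat3 (γ₁ ∪ γ₂) x y s) (pat3 ((E₁ ∪ E₂) \ (γ₁ ∪ γ₂)) x y s) : ℝ)) := rfl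
  rw [← this]
  linarith

end Functionals

end FK

end Summit.CriticalPhenomena.PercolationContinuityZ3.Theorems

end
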